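import Literature.Computability.Complexity.InstanceCompression
import Literature.Computability.Complexity.CanonicalCodes
import Literature.Computability.Complexity.ListFoldChecks
import Literature.Computability.Complexity.LengthCompare
import Literature.Computability.Complexity.FPStringBricks
import Literature.Computability.Complexity.PairPlumbing
import Literature.Computability.Complexity.NPClosureProofs
import Literature.Computability.Complexity.PPolyReductions
import Literature.Computability.Complexity.CookLevinSAT
import HarnessLib

/-!
# Instance compression: proof of Fortnow–Santhanam, Thm. 1.2 (= Thm. 3.1)

Discharge (D-0014) of the named fact
`Literature.Computability.Complexity.orSAT_compressible_imp_coNP_subset_polyAdvice_NP` of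
`InstanceCompression.lean`: **if OR-SAT is compressible then `coNP ⊆ NP/poly`**
(L. Fortnow, R. Santhanam, *Infeasibility of instance compression and succinct PCPs for NP*,
JCSS 77 (2011) = STOC 2008, Thm. 1.2, proved as Thm. 3.1 in §3). The formalization FOLLOWS THE
PRINTED PROOF of Thm. 3.1 (§3, "Proof."), in its three movements:

1. **The covering (advice) lemma** (`FortnowSanthanam.cover_step`, `FortnowSanthanam.cover`,
   `FortnowSanthanam.exists_advice`). Printed: fix `m` (there `m = n^c`), let `S₀` be the
   unsatisfiable formulae of size `n`; "Stage `i`: for each `y` let `B_y` be the set of `φ ∈ Sᵢ₋₁`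
   such that `y` is `φ`-good [some tuple of `Sᵢ₋₁^m` containing `φ` is mapped to `y`]. Pick `yᵢ`
   maximizing `|B_{yᵢ}|`, put `yᵢ` in `C`, `Sᵢ = Sᵢ₋₁ − B_{yᵢ}` … `|B_{yᵢ}| ≥ |S|/2`, thus there are
   at most `n + 1` stages", the bound coming from the pigeonhole count "`X_y ⊆ (B_y)^m`" over the
   fewer than `2^m` possible compressed values. Here: `cover_step` is one stage (the counting
   `|S|^m = Σ_y |X_y| ≤ Σ_y |B_y|^m`, so some `y` has `|S| < 2|B_y|` as soon as the target set has
   `< 2^m` elements), `cover` iterates it (`|S| < 2^k` ⇒ at most `k` strings), and `exists_advice`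
   instantiates it at length `n` with `S₀ = U_n :=` the strings of length `n` outside `SAT`
   (non-codewords included — the compression hypothesis speaks about membership in `SAT` of
   arbitrary strings), `m := p(n) + 1` (the compressed values have length `≤ p(n)`, and there are
   `< 2^(p(n)+1)` such strings, `card_stringsUpTo_lt`), giving `≤ n + 1` advice strings, each of
   which is a compressed value of an all-unsatisfiable tuple (hence outside `A`), such that every
   `x ∈ U_n` sits in a tuple of `U_n^m` compressed into the advice.
2. **The `NP` machine with advice** (namespace `FortnowSanthanam`, `verLang`, `mem_verLang_iff`).
   Printed: "We guess `φ₁, …, φ_m` each of size `n` such that `φ = φᵢ` for some `i`, and check that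
   `f(φ₁, …, φ_m, 1ⁿ) ∈ C`, accepting if it does … If a tuple containing `φ` maps to `C`, `φ` is
   unsatisfiable, since `C ⊆ T` [`T ⊆ Ā`]. Conversely, `C` contains a `y` that is `φ`-good." Here the
   certificate is the pair `⟨W₁, W₂⟩` of the tuple's items before and after `φ = x` (header-counted
   list codes, `codeW`), so that "`φ = φᵢ` for some `i`" holds by construction: the verifier
   re-encodes both halves into genuine list codes (`reenc = sndF ∘ canonListFn id`, total on
   malformed certificates), forms the tuple code `reenc W₁ ++ ⟨x, reenc W₂⟩ = encList (items)`,
   checks that every item has length `≤ |x|` (`allFn (lenLeFn X)` — the printed "each of size `n`",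
   needed because the compression hypothesis only binds tuples of strings of length `≤ n`), applies
   the compressor to `⟨tuple, 1^{|x|}⟩` and tests membership of the result among the advice strings
   (`anyFn eqPairFn`). All of it is assembled from the tree's `FP` bricks, so the verifier language
   is in `P` (`verLang_mem_P`) and its semantics is a closed formula on every input
   (`mem_verLang_iff`); `compl_SAT_mem_polyAdvice_NP` concludes `SATᶜ ∈ NP/poly`
   (`polyAdvice NP`, Arora–Barak Def. 6.16).
3. **From `SATᶜ` to `coNP`** (`coNP_subset_polyAdvice_NP_of_compl_SAT`). Printed: "We show coNP is
   in NP/poly by giving an NP algorithm with advice for deciding unsatisfiability" — i.e. through the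
   coNP-completeness of unsatisfiability; here: every `L ∈ coNP` has `Lᶜ ≤ₚ SAT` by the tree's
   Cook–Levin theorem (`SAT_isNPHard_holds`, `CookLevinSAT.lean`), so `L = g⁻¹(SATᶜ)`, and
   `NP/poly` is closed under `FP` preimages (`preimage_mem_polyAdvice` with `preimage_mem_NP`).

The PH collapse ("hence PH collapses to the third level [Yap]") is not part of the fact (see its
docstring). Deviations from the printed text: tuples range over ALL strings of length `n` outside
`SAT` rather than unsatisfiable formulae (immaterial, see 1.); `m = p(n) + 1` for the given output
bound `p` instead of the padding normalisation "`|f(…)| = n^c`, `m = n^c`"; the maximizing `yᵢ` is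
replaced by any `y` with `|B_y| > |S|/2` (which is all the printed proof uses).

## References

* [FortnowSanthanam2011] L. Fortnow, R. Santhanam, *Infeasibility of instance compression and
  succinct PCPs for NP*, J. Comput. System Sci. 77 (2011) 91–106 (STOC 2008), Thm. 1.2, §3
  Thm. 3.1 and its proof (held: `paper:doi-10-1145-1374376-1374398`, the proof is chunk 7).
* S. Arora, B. Barak, *Computational Complexity: A Modern Approach*, CUP 2009, Def. 2.1 (NP by
  certificates), Def. 6.16 (advice classes), Thm. 2.8 (closure under reductions), Lemma 2.11
  (Cook–Levin).
-/

namespace Literature.Computability.Complexity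

open _root_.Computability Brick Polynomial Finset

namespace FortnowSanthanam

/-! ### 1. The covering lemma (the "stage-wise process" of the proof of Thm. 3.1) -/

section Cover

variable {α β : Type*} [DecidableEq α] [DecidableEq β]

/-- **One stage of the Fortnow–Santhanam process.** For a map `F` sending `m`-tuples over `S`
into a set `T` with fewer than `2^m` elements, and `S` nonempty, some value `y ∈ T` is *good* for
more than half of `S`: the set `B ⊆ S` of elements occurring in a tuple of `S^m` mapped to `y`
has `|S| < 2|B|`. (Printed: "`X_y ⊆ (B_y)^m` … thus `|B_{yᵢ}| ≥ |S|/2`"; the count is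
`|S|^m = Σ_{y ∈ T} |X_y| ≤ Σ_{y ∈ T} |B_y|^m`, and if every `2|B_y| ≤ |S|` this is
`≤ |T| · |S|^m / 2^m < |S|^m`.) [cite: FortnowSanthanam2011, Thm 3.1 (proof, Stage i)] -/
theorem cover_step {m : ℕ} (F : (Fin m → α) → β) (S : Finset α) (T : Finset β)
    (hT : T.card < 2 ^ m) (hF : ∀ v ∈ Fintype.piFinset (fun _ : Fin m => S), F v ∈ T)
    (hS : S.Nonempty) :
    ∃ y ∈ T, ∃ B ⊆ S, S.card < 2 * B.card ∧
      ∀ x ∈ B, ∃ v ∈ Fintype.piFinset (fun _ : Fin m => S), (∃ i, v i = x) ∧ F v = y := by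
  classical
  -- `B y` : the elements of `S` occurring in a tuple of `S^m` mapped to `y`
  let B : β → Finset α := fun y =>
    S.filter fun x => ∃ v ∈ Fintype.piFinset (fun _ : Fin m => S), (∃ i, v i = x) ∧ F v = y
  have hBspec : ∀ y, ∀ x ∈ B y, ∃ v ∈ Fintype.piFinset (fun _ : Fin m => S),
      (∃ i, v i = x) ∧ F v = y := fun y x hx => (Finset.mem_filter.1 hx).2
  have hBsub : ∀ y, B y ⊆ S := fun y => Finset.filter_subset _ _
  by_contra hcon
  have hle : ∀ y ∈ T, 2 * (B y).card ≤ S.card := fun y hy => by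
    by_contra h
    exact hcon ⟨y, hy, B y, hBsub y, lt_of_not_ge h, hBspec y⟩
  -- the tuples and their fibres
  set P : Finset (Fin m → α) := Fintype.piFinset (fun _ : Fin m => S) with hP
  have hPcard : P.card = S.card ^ m := Fintype.card_piFinset_const S m
  have hfib : P.card = ∑ y ∈ T, (P.filter fun v => F v = y).card :=
    Finset.card_eq_sum_card_fiberwise fun v hv => hF v hv
  have hfible : ∀ y ∈ T, 2 ^ m * (P.filter fun v => F v = y).card ≤ S.card ^ m := by
    intro y hy
    -- `X_y ⊆ (B_y)^m`
    have hsub : (P.filter fun v => F v = y) ⊆ Fintype.piFinset (fun _ : Fin m => B y) := by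
      intro v hv
      rw [Finset.mem_filter] at hv
      rw [Fintype.mem_piFinset]
      intro i
      exact Finset.mem_filter.2 ⟨Fintype.mem_piFinset.1 hv.1 i, v, hv.1, ⟨i, rfl⟩, hv.2⟩
    have h1 : (P.filter fun v => F v = y).card ≤ (B y).card ^ m := by
      simpa [Fintype.card_piFinset_const] using Finset.card_le_card hsub
    calc 2 ^ m * (P.filter fun v => F v = y).card ≤ 2 ^ m * (B y).card ^ m :=
          Nat.mul_le_mul_left _ h1
      _ = (2 * (B y).card) ^ m := by rw [Nat.mul_pow]
      _ ≤ S.card ^ m := Nat.pow_le_pow_left (hle y hy) m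
  have hpos : 0 < S.card ^ m := Nat.pow_pos (Finset.card_pos.2 hS)
  have key : 2 ^ m * S.card ^ m ≤ T.card * S.card ^ m :=
    calc 2 ^ m * S.card ^ m = 2 ^ m * P.card := by rw [hPcard]
      _ = ∑ y ∈ T, 2 ^ m * (P.filter fun v => F v = y).card := by rw [hfib, Finset.mul_sum]
      _ ≤ ∑ y ∈ T, S.card ^ m := Finset.sum_le_sum hfible
      _ = T.card * S.card ^ m := by rw [Finset.sum_const, smul_eq_mul]
  have : 2 ^ m ≤ T.card := Nat.le_of_mul_le_mul_right key hpos
  omega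

/-- **The whole stage-wise process.** Under the hypotheses of `cover_step` (for tuples over `U`),
every `S ⊆ U` with `|S| < 2^k` is *covered* by a list `C` of at most `k` values of `F` on `U^m`:
every `x ∈ S` occurs in a tuple of `U^m` whose value is in `C`. (Printed: "`|Sᵢ|` drops by at
least a factor `2` with each increment in `i`; therefore there are at most `n + 1` stages before
`Sᵢ` is empty.") [cite: FortnowSanthanam2011, Thm 3.1 (proof, the set C)] -/
theorem cover {m : ℕ} (F : (Fin m → α) → β) (U : Finset α) (T : Finset β)
    (hT : T.card < 2 ^ m) (hF : ∀ v ∈ Fintype.piFinset (fun _ : Fin m => U), F v ∈ T) :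
    ∀ (k : ℕ) (S : Finset α), S ⊆ U → S.card < 2 ^ k →
      ∃ C : List β, C.length ≤ k ∧
        (∀ y ∈ C, ∃ v ∈ Fintype.piFinset (fun _ : Fin m => U), F v = y) ∧
        ∀ x ∈ S, ∃ v ∈ Fintype.piFinset (fun _ : Fin m => U), (∃ i, v i = x) ∧ F v ∈ C := by
  have hmono : ∀ {S : Finset α}, S ⊆ U → ∀ v ∈ Fintype.piFinset (fun _ : Fin m => S),
      v ∈ Fintype.piFinset (fun _ : Fin m => U) := fun hSU v hv =>
    Fintype.mem_piFinset.2 fun i => hSU (Fintype.mem_piFinset.1 hv i)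
  intro k
  induction k with
  | zero =>
    intro S _ hS
    have hS0 : S = ∅ := Finset.card_eq_zero.1 (by simpa using hS)
    exact ⟨[], le_rfl, by simp, by simp [hS0]⟩
  | succ k ih =>
    intro S hSU hS
    rcases S.eq_empty_or_nonempty with hS0 | hSne
    · exact ⟨[], Nat.zero_le _, by simp, by simp [hS0]⟩
    obtain ⟨y, -, B, hBS, hcard, hB⟩ :=
      cover_step F S T hT (fun v hv => hF v (hmono hSU v hv)) hSne
    obtain ⟨C, hClen, hCval, hCcov⟩ := ih (S \ B) (Finset.sdiff_subset.trans hSU) (by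
      rw [Finset.card_sdiff_of_subset hBS, pow_succ] at *; omega)
    refine ⟨y :: C, by simpa using hClen, ?_, ?_⟩
    · intro y' hy'
      rcases List.mem_cons.1 hy' with rfl | hy'
      · -- `B` is nonempty; any of its elements exhibits `y` as a value on `S^m ⊆ U^m`
        have hBne : B.Nonempty := by
          rw [← Finset.card_pos]; have := Finset.card_pos.2 hSne; omega
        obtain ⟨x, hx⟩ := hBne
        obtain ⟨v, hv, -, hFv⟩ := hB x hx
        exact ⟨v, hmono hSU v hv, hFv⟩
      · exact hCval y' hy'
    · intro x hx
      by_cases hxB : x ∈ B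
      · obtain ⟨v, hv, hi, hFv⟩ := hB x hxB
        exact ⟨v, hmono hSU v hv, hi, by simp [hFv]⟩
      · obtain ⟨v, hv, hi, hFv⟩ := hCcov x (Finset.mem_sdiff.2 ⟨hx, hxB⟩)
        exact ⟨v, hv, hi, List.mem_cons_of_mem _ hFv⟩

end Cover

/-! ### Counting bit strings -/

/-- The bit strings of length `n`, as a `Finset`. [folklore] -/
def stringsOfLength (n : ℕ) : Finset (List Bool) :=
  (Finset.univ : Finset (Fin n → Bool)).image List.ofFn

/-- Membership in `stringsOfLength n` is having length `n`. [folklore] -/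
theorem mem_stringsOfLength {n : ℕ} {x : List Bool} : x ∈ stringsOfLength n ↔ x.length = n := by
  constructor
  · intro h
    obtain ⟨v, -, rfl⟩ := Finset.mem_image.1 h
    simp
  · rintro rfl
    exact Finset.mem_image.2 ⟨x.get, Finset.mem_univ _, List.ofFn_get x⟩

/-- There are at most `2^n` strings of length `n`. [folklore] -/
theorem card_stringsOfLength_le (n : ℕ) : (stringsOfLength n).card ≤ 2 ^ n :=
  Finset.card_image_le.trans (by simp)

/-- The bit strings of length at most `k`, as a `Finset`. [folklore] -/
def stringsUpTo (k : ℕ) : Finset (List Bool) :=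
  (Finset.range (k + 1)).biUnion stringsOfLength

/-- Membership in `stringsUpTo k` is having length `≤ k`. [folklore] -/
theorem mem_stringsUpTo {k : ℕ} {x : List Bool} : x ∈ stringsUpTo k ↔ x.length ≤ k := by
  simp only [stringsUpTo, Finset.mem_biUnion, Finset.mem_range, mem_stringsOfLength]
  constructor
  · rintro ⟨j, hj, hx⟩; omega
  · intro h; exact ⟨x.length, by omega, rfl⟩

/-- **There are fewer than `2^(k+1)` strings of length at most `k`** (the count behind "fix
`m`": the compressed values of tuples of unsatisfiable strings range over fewer than `2^m` strings).
[folklore] -/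
theorem card_stringsUpTo_lt (k : ℕ) : (stringsUpTo k).card < 2 ^ (k + 1) :=
  calc (stringsUpTo k).card ≤ ∑ j ∈ Finset.range (k + 1), (stringsOfLength j).card :=
        Finset.card_biUnion_le
    _ ≤ ∑ j ∈ Finset.range (k + 1), 2 ^ j := Finset.sum_le_sum fun _ _ => card_stringsOfLength_le _
    _ < 2 ^ (k + 1) := Nat.geomSum_lt le_rfl fun _ hj => Finset.mem_range.1 hj

/-! ### List codes -/

/-- The tuple code of `IsORCompression` is the tree's `encList`: `xs.foldr boolPair [] = encList xs`.
[folklore] -/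
theorem foldr_boolPair_nil (xs : List (List Bool)) : xs.foldr boolPair [] = encList xs := by
  induction xs with
  | nil => rfl
  | cons a xs ih => rw [List.foldr_cons, ih, encList_cons]

/-- Splicing an item into a list code is string concatenation:
`encList (l₁ ++ a :: l₂) = encList l₁ ++ ⟨a, encList l₂⟩`. [folklore] -/
theorem encList_append_cons (l₁ : List (List Bool)) (a : List Bool) (l₂ : List (List Bool)) :
    encList (l₁ ++ a :: l₂) = encList l₁ ++ boolPair a (encList l₂) := by
  induction l₁ with
  | nil => rfl
  | cons b l₁ ih =>
    rw [List.cons_append, encList_cons, ih, encList_cons]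
    simp [boolPair, List.append_assoc]

/-- Length of a list code all of whose items have length `≤ B`. [folklore] -/
theorem length_encList_le {l : List (List Bool)} {B : ℕ} (h : ∀ a ∈ l, a.length ≤ B) :
    (encList l).length ≤ l.length * (2 * B + 2) := by
  induction l with
  | nil => simp
  | cons a l ih =>
    have ha := h a (by simp)
    have ih' := ih fun b hb => h b (by simp [hb])
    rw [encList_cons, length_boolPair, List.length_cons]
    nlinarith

/-- The total decoder of a header-counted list code `⟨h, body⟩`: `|h|` items read off the body with
`boolUnpair` (the tree's `NegCNF.decList id`, i.e. Mathlib's `listBoolDecode` made total). [folklore] -/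
def decW (W : List Bool) : List (List Bool) :=
  NegCNF.decList id (boolUnpair W).1.length (boolUnpair W).2

/-- The header-counted code `⟨1^{|l|}, encList l⟩` of a list of strings (the certificate format).
[folklore] -/
def codeW (l : List (List Bool)) : List Bool :=
  boolPair (List.replicate l.length true) (encList l)

/-- `decList id` inverts `encList` given the right count. [folklore] -/
theorem decList_id_encList : ∀ l : List (List Bool), NegCNF.decList id l.length (encList l) = l
  | [] => rfl
  | a :: l => by
    rw [List.length_cons, NegCNF.decList, encList_cons, boolUnpair_boolPair]
    exact congrArg (List.cons a) (decList_id_encList l)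

/-- `decW` inverts `codeW`. [folklore] -/
@[simp] theorem decW_codeW (l : List (List Bool)) : decW (codeW l) = l := by
  rw [decW, codeW, boolUnpair_boolPair, List.length_replicate]
  exact decList_id_encList l

/-- Length of a certificate half. [folklore] -/
theorem length_codeW_le {l : List (List Bool)} {B : ℕ} (h : ∀ a ∈ l, a.length ≤ B) :
    (codeW l).length ≤ 2 * l.length + 2 + l.length * (2 * B + 2) := by
  rw [codeW, length_boolPair, List.length_replicate]
  have := length_encList_le h
  omega

/-- **The re-encoder** `reenc = sndF ∘ canonListFn id`: on EVERY string, a genuine list code (of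
the decoded items, `reenc_apply`) — so the compressor is only ever queried on well-formed tuple
codes, whatever the certificate. [folklore] -/
noncomputable def reenc : List Bool → List Bool := sndF ∘ CanonCode.canonListFn id

/-- `reenc ∈ FP`. [cite: AroraBarakCC2009, §1.3] -/
theorem reenc_mem_FP : reenc ∈ FP :=
  comp_mem_FP sndF_mem_FP (CanonCode.canonListFn_mem_FP OracleCompose.id_mem_FP (a := 0) fun _ => le_rfl)

/-- **Value of the re-encoder**: `reenc W = encList (decW W)`. [folklore] -/
theorem reenc_apply (W : List Bool) : reenc W = encList (decW W) := by
  rw [reenc, Function.comp_apply, CanonCode.canonListFn_apply, sndF_boolPair,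
    CanonCode.itemsCanon_eq_frames, List.map_id, frames_eq_encList]
  rfl

/-! ### 2. The `NP` verifier with advice ("guess `φ₁, …, φ_m` with `φ = φᵢ`, check `f(…) ∈ C`")

Inputs are `z = ⟨⟨x, adv⟩, w⟩` (instance, advice, certificate), `w = ⟨W₁, W₂⟩`. -/

/-- The instance `x` of `⟨⟨x, adv⟩, w⟩`. [folklore] -/
noncomputable def xF : List Bool → List Bool := fstF ∘ fstF

/-- The advice `adv` of `⟨⟨x, adv⟩, w⟩`. [folklore] -/
noncomputable def advF : List Bool → List Bool := sndF ∘ fstF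

/-- `xF ∈ FP`. [cite: AroraBarakCC2009, §1.3] -/
theorem xF_mem_FP : xF ∈ FP := comp_mem_FP fstF_mem_FP fstF_mem_FP

/-- `advF ∈ FP`. [cite: AroraBarakCC2009, §1.3] -/
theorem advF_mem_FP : advF ∈ FP := comp_mem_FP sndF_mem_FP fstF_mem_FP

/-- **The guessed tuple** as a genuine list code: `reenc W₁ ++ ⟨x, reenc W₂⟩` (the instance spliced
between the two certificate halves, so that "`φ = φᵢ` for some `i`" holds by construction).
[cite: FortnowSanthanam2011, Thm 3.1 (proof, the NP algorithm with advice)] -/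
noncomputable def tupleF : List Bool → List Bool := fun z =>
  (reenc ∘ fstF ∘ sndF) z ++ fanoutFn xF (reenc ∘ sndF ∘ sndF) z

/-- `tupleF ∈ FP`. [cite: AroraBarakCC2009, §1.3] -/
theorem tupleF_mem_FP : tupleF ∈ FP :=
  append_mem_FP (comp_mem_FP reenc_mem_FP (comp_mem_FP fstF_mem_FP sndF_mem_FP))
    (fanoutFn_mem_FP xF_mem_FP (comp_mem_FP reenc_mem_FP (comp_mem_FP sndF_mem_FP sndF_mem_FP)))

/-- The items of the guessed tuple: decoded first half, the instance, decoded second half.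
[folklore] -/
def items (x w : List Bool) : List (List Bool) := decW (fstF w) ++ x :: decW (sndF w)

/-- **Value of `tupleF`**: the list code of `items`. [folklore] -/
theorem tupleF_apply (x adv w : List Bool) :
    tupleF (boolPair (boolPair x adv) w) = encList (items x w) := by
  simp only [tupleF, Function.comp_apply, fanoutFn_apply, xF, fstF_boolPair, sndF_boolPair,
    reenc_apply, items, encList_append_cons]

/-- **The size test** "each of size `n`": every item has length `≤ |x|` (`allFn (lenLeFn X)` on
`⟨x, tuple⟩`). [cite: FortnowSanthanam2011, Thm 3.1 (proof, the NP algorithm with advice)] -/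
noncomputable def lenOKF : List Bool → List Bool := allFn (lenLeFn X) ∘ fanoutFn xF tupleF

/-- `lenLeFn p` is one-bit. [folklore] -/
theorem oneBit_lenLeFn (p : Polynomial ℕ) : OneBit (lenLeFn p) := fun w => by
  rcases lenLeFn_eq_or p w with h | h <;> exact ⟨_, h⟩

/-- `lenOKF ∈ FP`. [cite: AroraBarakCC2009, §1.3] -/
theorem lenOKF_mem_FP : lenOKF ∈ FP :=
  comp_mem_FP (allFn_mem_FP (lenLeFn_mem_FP X) (oneBit_lenLeFn X)) (fanoutFn_mem_FP xF_mem_FP tupleF_mem_FP)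

/-- `lenOKF` is one-bit. [folklore] -/
theorem oneBit_lenOKF : OneBit lenOKF := (oneBit_allFn (oneBit_lenLeFn X)).comp _

/-- **Truth of the size test.** [folklore] -/
theorem lenOKF_eq_true_iff (x adv w : List Bool) :
    lenOKF (boolPair (boolPair x adv) w) = [true] ↔ ∀ a ∈ items x w, a.length ≤ x.length := by
  rw [lenOKF, Function.comp_apply, fanoutFn_apply, tupleF_apply, allFn_boolPair_eq_true (oneBit_lenLeFn X),
    decNil_encList]
  simp only [xF, Function.comp_apply, fstF_boolPair, lenLeFn_boolPair, eval_X, List.cons.injEq, and_true,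
    decide_eq_true_eq]

/-- **The query** `⟨tuple, 1^{|x|}⟩` handed to the compressor (`f(φ₁, …, φ_m, 1ⁿ)`).
[cite: FortnowSanthanam2011, Thm 3.1 (proof, the NP algorithm with advice)] -/
noncomputable def queryF : List Bool → List Bool := fanoutFn tupleF (onesFn ∘ xF)

/-- `queryF ∈ FP`. [cite: AroraBarakCC2009, §1.3] -/
theorem queryF_mem_FP : queryF ∈ FP :=
  fanoutFn_mem_FP tupleF_mem_FP (comp_mem_FP onesFn_mem_FP xF_mem_FP)

/-- **Value of the query.** [folklore] -/
theorem queryF_apply (x adv w : List Bool) :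
    queryF (boolPair (boolPair x adv) w) = boolPair (encList (items x w)) (List.replicate x.length true) := by
  rw [queryF, fanoutFn_apply, tupleF_apply]
  simp only [Function.comp_apply, xF, fstF_boolPair, onesFn, OracleCompose.unaryEncodeNat_eq_replicate]

/-- **The advice test** "check that `f(φ₁, …, φ_m, 1ⁿ) ∈ C`": the compressed query equals one of the
advice strings (`anyFn eqPairFn` on `⟨f query, adv⟩`).
[cite: FortnowSanthanam2011, Thm 3.1 (proof, the NP algorithm with advice)] -/
noncomputable def memOKF (f : List Bool → List Bool) : List Bool → List Bool :=
  anyFn eqPairFn ∘ fanoutFn (f ∘ queryF) advF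

/-- `memOKF f ∈ FP` for `f ∈ FP`. [cite: AroraBarakCC2009, §1.3] -/
theorem memOKF_mem_FP {f : List Bool → List Bool} (hf : f ∈ FP) : memOKF f ∈ FP :=
  comp_mem_FP (anyFn_mem_FP eqPairFn_mem_FP oneBit_eqPairFn)
    (fanoutFn_mem_FP (comp_mem_FP hf queryF_mem_FP) advF_mem_FP)

/-- `memOKF f` is one-bit. [folklore] -/
theorem oneBit_memOKF (f : List Bool → List Bool) : OneBit (memOKF f) := (oneBit_anyFn oneBit_eqPairFn).comp _

/-- **Truth of the advice test** (for a genuine advice list code). [folklore] -/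
theorem memOKF_eq_true_iff (f : List Bool → List Bool) (x w : List Bool) (Y : List (List Bool)) :
    memOKF f (boolPair (boolPair x (encList Y)) w) = [true] ↔
      f (boolPair (encList (items x w)) (List.replicate x.length true)) ∈ Y := by
  rw [memOKF, Function.comp_apply, fanoutFn_apply, anyFn_boolPair_eq_true oneBit_eqPairFn]
  simp only [Function.comp_apply, queryF_apply, advF, sndF_boolPair, fstF_boolPair, decNil_encList,
    eqPairFn_boolPair_eq_true]
  constructor
  · rintro ⟨a, ha, rfl⟩; exact ha
  · intro h; exact ⟨_, h, rfl⟩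

/-- **The verdict**: size test and advice test. [cite: FortnowSanthanam2011, Thm 3.1 (proof)] -/
noncomputable def verdictF (f : List Bool → List Bool) : List Bool → List Bool := andFn lenOKF (memOKF f)

/-- `verdictF f ∈ FP` for `f ∈ FP` ("`f` computable in deterministic time poly(m, n)").
[cite: AroraBarakCC2009, §1.3] -/
theorem verdictF_mem_FP {f : List Bool → List Bool} (hf : f ∈ FP) : verdictF f ∈ FP :=
  andFn_mem_FP lenOKF_mem_FP (memOKF_mem_FP hf)

/-- `verdictF f` is one-bit. [folklore] -/
theorem oneBit_verdictF (f : List Bool → List Bool) : OneBit (verdictF f) :=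
  oneBit_andFn oneBit_lenOKF (oneBit_memOKF f)

/-- **The verifier language** `{z | verdictF f z = [1]}` (the polynomial-time relation behind the
"NP algorithm with advice"). [cite: FortnowSanthanam2011, Thm 3.1 (proof)] -/
def verLang (f : List Bool → List Bool) : Language Bool := {z | verdictF f z = [true]}

/-- **The verifier language is in `P`** (for `f ∈ FP`). [cite: AroraBarakCC2009, Def. 1.13 and §1.3] -/
theorem verLang_mem_P {f : List Bool → List Bool} (hf : f ∈ FP) : verLang f ∈ Classes.P :=
  mem_P_of_mem_FP (verdictF_mem_FP hf) _ fun z =>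
    ⟨fun h => h, fun h => by
      obtain ⟨b, hb⟩ := oneBit_verdictF f z
      cases b
      · exact hb
      · exact absurd hb h⟩

/-- **Semantics of the verifier on every certificate**: with advice the list code of `Y`,
`⟨⟨x, encList Y⟩, w⟩` is accepted iff every item of the guessed tuple has length `≤ |x|` and the
compressor sends `⟨tuple, 1^{|x|}⟩` into `Y`. [cite: FortnowSanthanam2011, Thm 3.1 (proof)] -/
theorem mem_verLang_iff (f : List Bool → List Bool) (x w : List Bool) (Y : List (List Bool)) :
    boolPair (boolPair x (encList Y)) w ∈ verLang f ↔
      (∀ a ∈ items x w, a.length ≤ x.length) ∧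
        f (boolPair (encList (items x w)) (List.replicate x.length true)) ∈ Y := by
  change verdictF f _ = [true] ↔ _
  rw [verdictF, andFn_eq_true_iff oneBit_lenOKF (oneBit_memOKF f), lenOKF_eq_true_iff, memOKF_eq_true_iff]

/-- The items of the honest certificate `⟨codeW l₁, codeW l₂⟩` are `l₁ ++ x :: l₂`. [folklore] -/
theorem items_codeW (x : List Bool) (l₁ l₂ : List (List Bool)) :
    items x (boolPair (codeW l₁) (codeW l₂)) = l₁ ++ x :: l₂ := by
  simp [items]

/-! ### The advice for length `n` -/

/-- **The advice set `C` of the proof of Thm. 3.1, at length `n`.** For an OR-compression `f` of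
`SAT` into `A` with output bound `p`: at most `n + 1` strings, each the compressed value of a
tuple of strings of length `n` outside `SAT` — hence outside `A` and of length `≤ p(n)` — such
that every `x ∉ SAT` of length `n` lies in a tuple of `m = p(n) + 1` such strings compressed into
`C` (`cover` with `S₀ = U_n`, `|U_n| ≤ 2^n < 2^(n+1)`, target the `< 2^m` strings of length
`≤ p(n)`). [cite: FortnowSanthanam2011, Thm 3.1 (proof, "a polynomial-size C with the property we require")] -/
theorem exists_advice {f : List Bool → List Bool} {A : Set (List Bool)} {p : Polynomial ℕ}
    (hc : IsORCompression SAT f A fun n => p.eval n) (n : ℕ) :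
    ∃ C : List (List Bool), C.length ≤ n + 1 ∧
      (∀ y ∈ C, y ∉ A ∧ y.length ≤ p.eval n) ∧
      ∀ x : List Bool, x.length = n → x ∉ SAT →
        ∃ l : List (List Bool), l.length = p.eval n + 1 ∧ (∀ a ∈ l, a.length = n) ∧ x ∈ l ∧
          f (boolPair (encList l) (List.replicate n true)) ∈ C := by
  classical
  set m := p.eval n + 1 with hm
  let U : Finset (List Bool) := (stringsOfLength n).filter fun x => x ∉ SAT
  let F : (Fin m → List Bool) → List Bool := fun v =>
    f (boolPair (encList (List.ofFn v)) (List.replicate n true))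
  have hU : ∀ x, x ∈ U ↔ x.length = n ∧ x ∉ SAT := fun x => by
    simp only [U, Finset.mem_filter, mem_stringsOfLength]
  -- the values of `F` on `U^m`: outside `A`, of length `≤ p(n)`
  have hFval : ∀ v ∈ Fintype.piFinset (fun _ : Fin m => U), F v ∉ A ∧ (F v).length ≤ p.eval n := by
    intro v hv
    have hv' : ∀ i, (v i).length = n ∧ v i ∉ SAT := fun i => (hU _).1 (Fintype.mem_piFinset.1 hv i)
    have hlen : ∀ a ∈ List.ofFn v, a.length ≤ n := by
      intro a ha
      obtain ⟨i, rfl⟩ := List.mem_ofFn.1 ha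
      exact (hv' i).1.le
    obtain ⟨h1, h2⟩ := hc n (List.ofFn v) hlen
    rw [foldr_boolPair_nil] at h1 h2
    refine ⟨fun hA => ?_, h1⟩
    obtain ⟨a, ha, haS⟩ := h2.1 hA
    obtain ⟨i, rfl⟩ := List.mem_ofFn.1 ha
    exact (hv' i).2 haS
  have hT : (stringsUpTo (p.eval n)).card < 2 ^ m := card_stringsUpTo_lt _
  have hFT : ∀ v ∈ Fintype.piFinset (fun _ : Fin m => U), F v ∈ stringsUpTo (p.eval n) :=
    fun v hv => mem_stringsUpTo.2 (hFval v hv).2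
  have hUcard : U.card < 2 ^ (n + 1) :=
    lt_of_le_of_lt ((Finset.filter_subset _ _ |> Finset.card_le_card).trans (card_stringsOfLength_le n))
      (Nat.pow_lt_pow_succ one_lt_two)
  obtain ⟨C, hClen, hCval, hCcov⟩ := cover F U _ hT hFT (n + 1) U Finset.Subset.rfl hUcard
  refine ⟨C, hClen, fun y hy => ?_, fun x hx hxS => ?_⟩
  · obtain ⟨v, hv, rfl⟩ := hCval y hy
    exact hFval v hv
  · obtain ⟨v, hv, ⟨i, hi⟩, hFv⟩ := hCcov x ((hU x).2 ⟨hx, hxS⟩)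
    refine ⟨List.ofFn v, List.length_ofFn, fun a ha => ?_, ?_, hFv⟩
    · obtain ⟨j, rfl⟩ := List.mem_ofFn.1 ha
      exact ((hU _).1 (Fintype.mem_piFinset.1 hv j)).1
    · rw [← hi]
      exact List.mem_ofFn.2 ⟨i, rfl⟩

/-! ### `SATᶜ ∈ NP/poly` -/

/-- **`SATᶜ ∈ NP/poly` from an OR-compression of `SAT`** (the heart of Thm. 3.1: "an NP algorithm
with advice `C` for deciding unsatisfiability … If a tuple containing `φ` maps to `C`, `φ` is
unsatisfiable, since `C ⊆ T`. Conversely, `C` contains a `y` that is `φ`-good"). The advice at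
length `n` is the list code of the `C` of `exists_advice`; the `NP` language is
`{v | ∃ w, |w| ≤ q |v| ∧ ⟨v, w⟩ ∈ verLang f}`; soundness uses that the advice strings lie outside
`A` while a tuple (of strings of length `≤ n`) containing a satisfiable `x` is compressed INTO `A`;
completeness feeds the honest certificate `⟨codeW l₁, codeW l₂⟩` of the covering tuple
`l₁ ++ x :: l₂`. [cite: FortnowSanthanam2011, Thm 3.1 (proof)] -/
theorem compl_SAT_mem_polyAdvice_NP {f : List Bool → List Bool} {A : Set (List Bool)}
    {p : Polynomial ℕ} (hf : f ∈ FP) (hc : IsORCompression SAT f A fun n => p.eval n) :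
    SATᶜ ∈ polyAdvice Nondeterministic.NP := by
  choose C hClen hCval hCcov using exists_advice hc
  -- the certificate-length polynomial: two halves `codeW lᵢ`, `|lᵢ| ≤ m`, items of length `n`
  let B : Polynomial ℕ := 2 * (p + 1) + 2 + (p + 1) * (2 * X + 2)
  let q : Polynomial ℕ := 3 * B + 2
  have hBeval : ∀ n, B.eval n = 2 * (p.eval n + 1) + 2 + (p.eval n + 1) * (2 * n + 2) := fun n => by
    simp only [B, eval_add, eval_mul, eval_ofNat, eval_one, eval_X]
  have hqeval : ∀ n, q.eval n = 3 * B.eval n + 2 := fun n => by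
    simp only [q, eval_add, eval_mul, eval_ofNat]
  have hcode : ∀ (n : ℕ) (l : List (List Bool)), l.length ≤ p.eval n + 1 →
      (∀ a ∈ l, a.length ≤ n) → (codeW l).length ≤ B.eval n := by
    intro n l hl hln
    have h1 := length_codeW_le hln
    rw [hBeval]
    have h2 : l.length * (2 * n + 2) ≤ (p.eval n + 1) * (2 * n + 2) := Nat.mul_le_mul_right _ hl
    omega
  -- the `NP` language
  let L' : Language Bool := {v | ∃ w : List Bool, w.length ≤ q.eval v.length ∧ boolPair v w ∈ verLang f}
  have hL' : L' ∈ Nondeterministic.NP := ⟨verLang f, verLang_mem_P hf, q, fun v => Iff.rfl⟩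
  refine ⟨L', hL', fun n => encList (C n), (X + 1) * (2 * p + 2), fun n => ?_, fun x => ?_⟩
  · -- advice length `≤ (n + 1) (2 p(n) + 2)`
    have h1 := length_encList_le (l := C n) (B := p.eval n) fun y hy => (hCval n y hy).2
    have h2 : (C n).length * (2 * p.eval n + 2) ≤ (n + 1) * (2 * p.eval n + 2) :=
      Nat.mul_le_mul_right _ (hClen n)
    simp only [eval_mul, eval_add, eval_X, eval_one, eval_ofNat]
    exact h1.trans h2
  · -- correctness
    change x ∉ SAT ↔ ∃ w : List Bool, w.length ≤ q.eval (boolPair x (encList (C x.length))).length ∧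
      boolPair (boolPair x (encList (C x.length))) w ∈ verLang f
    constructor
    · -- completeness: the honest certificate of the covering tuple
      intro hx
      obtain ⟨l, hl, hln, hxl, hFl⟩ := hCcov x.length x rfl hx
      obtain ⟨l₁, l₂, rfl⟩ := List.append_of_mem hxl
      refine ⟨boolPair (codeW l₁) (codeW l₂), ?_, ?_⟩
      · have e₁ : (codeW l₁).length ≤ B.eval x.length :=
          hcode _ l₁ (by rw [← hl, List.length_append, List.length_cons]; omega)
            fun a ha => (hln a (by simp [ha])).le
        have e₂ : (codeW l₂).length ≤ B.eval x.length :=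
          hcode _ l₂ (by rw [← hl, List.length_append, List.length_cons]; omega)
            fun a ha => (hln a (by simp [ha])).le
        have hmono : q.eval x.length ≤ q.eval (boolPair x (encList (C x.length))).length :=
          TM2Iter.eval_mono q (by rw [length_boolPair]; omega)
        have hw : (boolPair (codeW l₁) (codeW l₂)).length ≤ q.eval x.length := by
          rw [length_boolPair, hqeval]; omega
        exact hw.trans hmono
      · rw [mem_verLang_iff, items_codeW]
        exact ⟨fun a ha => (hln a ha).le, hFl⟩
    · -- soundness: advice strings lie outside `A`
      rintro ⟨w, -, hw⟩ hxS
      rw [mem_verLang_iff] at hw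
      obtain ⟨hlen, hmem⟩ := hw
      obtain ⟨hnotA, -⟩ := hCval _ _ hmem
      have h2 := (hc x.length (items x w) hlen).2
      rw [foldr_boolPair_nil] at h2
      exact hnotA (h2.2 ⟨x, by simp [items], hxS⟩)

/-! ### 3. From `SATᶜ` to all of `coNP` -/

/-- **`coNP ⊆ NP/poly` as soon as `SATᶜ ∈ NP/poly`**: every `L ∈ coNP` has `Lᶜ ≤ₚ SAT`
(Cook–Levin, `SAT_isNPHard_holds`), so `L = g⁻¹(SATᶜ)` for the reduction `g ∈ FP`, and `NP/poly`
is closed under `FP` preimages (`preimage_mem_polyAdvice`, `preimage_mem_NP`).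
[cite: AroraBarakCC2009, Lemma 2.11 and Thm. 2.8] -/
theorem coNP_subset_polyAdvice_NP_of_compl_SAT (h : SATᶜ ∈ polyAdvice Nondeterministic.NP) :
    coNP ⊆ polyAdvice Nondeterministic.NP := by
  intro L hL
  have hhard : IsHard Nondeterministic.NP SAT := SAT_isNPHard_holds
  obtain ⟨g, hg, hgL⟩ := hhard Lᶜ hL
  -- `x ∈ L ↔ g x ∈ SATᶜ` (membership in a complement is non-membership, definitionally)
  have hc' : ∀ (K : Language Bool) (y : List Bool), y ∈ Kᶜ ↔ y ∉ K := fun _ _ => Iff.rfl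
  have hgL' : ∀ x, x ∈ L ↔ g x ∈ (SATᶜ : Language Bool) := fun x => by
    constructor
    · intro hx
      exact (hc' SAT (g x)).2 fun hS => (hc' L x).1 ((hgL x).2 hS) hx
    · intro hx
      by_contra hxL
      exact (hc' SAT (g x)).1 hx ((hgL x).1 ((hc' L x).2 hxL))
  have hpre : L = g ⁻¹' (SATᶜ : Language Bool) := Set.ext hgL'
  rw [hpre]
  exact preimage_mem_polyAdvice (K := Nondeterministic.NP)
    (fun L' hL' f hf => preimage_mem_NP hL' hf) h hg

end FortnowSanthanam

/-- **Discharge of `orSAT_compressible_imp_coNP_subset_polyAdvice_NP` — Fortnow–Santhanam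
(2008/2011), Thm. 1.2 (= Thm. 3.1): if OR-SAT is compressible (a polynomial-time `f`, an
arbitrary set `A` and a polynomial output bound, `IsORCompression SAT f A p`) then
`coNP ⊆ NP/poly`.** Proof as printed (§3): the covering advice `FortnowSanthanam.exists_advice`,
the `NP` verifier with advice `FortnowSanthanam.compl_SAT_mem_polyAdvice_NP` (`SATᶜ ∈ NP/poly`),
and the passage to `coNP` through the NP-hardness of `SAT`
(`FortnowSanthanam.coNP_subset_polyAdvice_NP_of_compl_SAT`).
[cite: FortnowSanthanam2011, Thm 1.2 (= Thm 3.1)] -/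
theorem orSAT_compressible_imp_coNP_subset_polyAdvice_NP_holds :
    orSAT_compressible_imp_coNP_subset_polyAdvice_NP := by
  rintro ⟨f, hf, A, p, hc⟩
  exact FortnowSanthanam.coNP_subset_polyAdvice_NP_of_compl_SAT
    (FortnowSanthanam.compl_SAT_mem_polyAdvice_NP hf hc)

end Literature.Computability.Complexity
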